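import Literature.MathematicalPhysics.QuantumFieldTheory.Balaban1983to89.Node00.BgRemainderOfRecord
import Literature.MathematicalPhysics.QuantumFieldTheory.Balaban1983to89.B9Eq310HessianHermitian
import Literature.MathematicalPhysics.QuantumFieldTheory.Balaban1983to89.B9Eq3124GaugeModes
import Summits.QuantumFields.YangMills.Theorems.BalabanUVNodesN07PrintProjectionOfRecord
import Summits.QuantumFields.YangMills.Theorems.BalabanUVNodesN07QOfRecordOntoSmallField
import HarnessLib

/-!
# NODE N07 — [B9] (3.10) «it is a hermitian operator» AT THE RECORD, OFF THE FLAT ORBIT: def-Y's HESSIAN `Δ(U₀) = hessOpOfRecord F N k U₀` IS SYMMETRIC AT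
# EVERY BACKGROUND (hypothesis-free), SO ARE THE SLOT-(b)∕(c) HESSIANS `π†Δπ`, `π†(Δ+Δ⁽²⁾)π` OF ✓3f′, AND `𝔊(U₀)` OF SLOT (c) MAPS THE CURRENTS INTO (102) AT EVERY
# GUARDED BACKGROUND — modulo only the displayed `hpos` ([B9] Thm 3.12) and `hQ`

Cell `pub-ymgap`, width seat `pub-ymgap-dag-n07-w3` (g25), INTENT-8 ∕ CLAIM-8.  `--kind proof --supports stmt-QuantumFields-27238 --as helper`; count-neutral.
[15] = [Balaban1985Variational]; [B9] = [Balaban1985BackgroundPropagators]; [B7] = [Balaban1985Averaging].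

WHAT.  def-Y's M2 file 3f′ (✓`Node00.BgRemainderOfRecord`) lists «the symmetry of `Δ(U₀)` off the flat orbit» among the things NOT asserted there; the tree had it
only on the flat orbit (g24's ✓`hessOpOfRecord_one_isSymmetric`, ✓`hessOpOfRecord_pureGauge_isSymmetric`).  lit ✓`B9Eq310HessianHermitian.hessOp_isSymmetric_of_trace`
proves print's sentence for ANY unitary background with a `*`-trace; its four letters hold at the record (`U₀(b) ∈ SU(N)`, `τ = tr`, `⟨φ⁻¹X, φ⁻¹Y⟩ = tr X⋆Y`):
* §1 `curvOpOfRecord_isSymmetric`, ★★★ `hessOpOfRecord_isSymmetric` — `Δ′(U₀)`, `Δ(U₀) = D*D + Δ′` symmetric at EVERY `U₀`, no hypothesis; `hessOpOfRecord_add_isSymmetric`.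
* §2 `isSymmetric_adjoint_comp_comp` (`T†ST` is symmetric with `S`), ★★ `hessOpOfRecordPi_isSymmetric` (3f′'s slot (b) `π†Δ(U₀)π`, ANY `G′`, `Q′`),
  ★★ `hessOpOfRecord128_isSymmetric` (slot (c) `π†(Δ(U₀)+Δ⁽²⁾)π`, symmetric datum `Δ⁽²⁾`), `laplaceAOfRecordAt_isSymmetric` ((110)'s `Δ₁ + DRD* + aQ*Q`).
* §3 ★★★ `frakGOfRecordAtBg128_mem_constraint102` — at every GUARDED background, print's `G′ := (T′)⁻¹`, any symmetric `Δ⁽²⁾`: `𝔊(U₀) f ∈ (102)` ((117)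
  «`Q𝔊 = 0, RD*𝔊 = 0`») for every current `f`, lit ✓`frakGLatticeCLM_mem_constraint102_of_gaugeModes` fed with (g1) := 3f′ ✓`hessOpOfRecord128_gaugeMode`,
  (g2) := ✓`QOfRecord_covDerivL2K_eq_zero_of_QflatOfRecord_eq_zero`, `hΔ` := §2 — modulo the displayed `hpos`, `hQ`; §4 the same on [15] (2)'s class `𝔘_k`
  with `hQ` and the guard DISCHARGED (✓`QOfRecord_surjective_of_inUkClassB11`) — modulo `hpos` alone.

HONEST LABELS.  Star-algebra ∕ adjoint bookkeeping and one packaging of landed reductions; NO estimate: [B9] Thm 3.11∕3.12 (`hpos`), (46), (117)'s bound `B₀` are NOT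
touched.  Count-neutral; N07 NOT discharged; P0 ⟨26900⟩ OPEN; R4 is the conditional finite-𝕋⁴ rung only.  Nothing here is a claim about the Yang–Mills mass gap
(`Summit.QuantumFields`): finite torus, fixed `ε`; nothing continuum ∕ OS ∕ Clay.
-/

set_option autoImplicit false

noncomputable section

open scoped Matrix Matrix.Norms.L2Operator InnerProductSpace ComplexConjugate

namespace Summit.QuantumFields.YangMills.Theorems.N07HessOpOfRecordSymmetric

open Literature.MathematicalPhysics.QuantumFieldTheory.Balaban1983to89
open Literature.MathematicalPhysics.QuantumFieldTheory.Balaban1983to89.T4Continuum (T4Family)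
open T4Continuum BlockAveraging
open B9SectCLatticeCarrier (Bond)
open B9Eq311L2Pairing (WL2)
open B9Eq310HessianOperator (curvOp)
open B9Eq310HessianHermitian (curvOp_isSymmetric hessOp_isSymmetric_of_trace)
open B11Eq111FrakG (nabla115 constraint102)
open B11Eq103H1Complex (SiteL2K BondL2K covDerivL2K covDivL2K covLaplaceSiteK laplaceALatticeK greenK QFun DstarFun laplaceALatticeK_isSymmetric)
open Node00
open Summit.QuantumFields.YangMills.Theorems.N07PrintProjectionOfRecord (printGreen_gaugeMode_ofRecord)
open Summit.QuantumFields.YangMills.Theorems.N07QOfRecordInfGauge (QOfRecord_covDerivL2K_eq_zero_of_QflatOfRecord_eq_zero)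
open Summit.QuantumFields.YangMills.BalabanUVNodes.N07QOfRecordOntoSmallField (QOfRecord_surjective_of_inUkClassB11)
open Summit.QuantumFields.YangMills.BalabanUVNodes.N07CritTangentConverse (smallBelow_of_plaqSmall)
open Summit.QuantumFields.YangMills.BalabanUVNodes.N07CritTangentInClass (plaqSmall_avgFamily_of_mem_bgReg)
open BlockAveragingEMLHaarAC (emlWeight)
open ExpMeanLog (deltaSU)
open Summit.QuantumFields.YangMills.Theorems.BlockAvgCorrector (stokesConst)

variable (F : T4Family) (N : ℕ) {K : ℕ} (k : ℕ)

/-! ## §1  The four letters of lit's «hermitian operator» at the record, and `Δ′(U₀)`, `Δ(U₀)` symmetric at every background -/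

/-- **THE RECORD'S BACKGROUND IS UNITARY**: `↑(unitsOfRecord U₀ a)⋆ = ↑(unitsOfRecord U₀ a)⁻¹` (`U₀(b) ∈ SU(N)`). [cite: Balaban1985BackgroundPropagators, (3.5) p.391] -/
theorem star_coe_unitsOfRecord (U₀ : GaugeField (F.P K) 0 (SU N)) (a : Bond (F.P K).d (fun _ => (F.P K).sitesPerDir 0)) :
    star (unitsOfRecord F N U₀ a : Matrix (Fin N) (Fin N) ℂ) = ((unitsOfRecord F N U₀ a)⁻¹ : (Matrix (Fin N) (Fin N) ℂ)ˣ) := by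
  rw [coe_unitsOfRecord, coe_unitsOfRecord_inv]

/-- **THE RECORD'S TRACE IS A `*`-TRACE**: `tr X⋆ = conj (tr X)`. [cite: Balaban1985BackgroundPropagators, p.391] -/
theorem tauRec_star (X : Matrix (Fin N) (Fin N) ℂ) : tauRec N (star X) = conj (tauRec N X) := by
  rw [Matrix.traceLinearMap_apply, Matrix.traceLinearMap_apply, Matrix.star_eq_conjTranspose, Matrix.trace_conjTranspose, Complex.star_def]

/-- **THE RECORD'S TRACE IS CYCLIC**: `tr XY = tr YX`. [cite: Balaban1985BackgroundPropagators, p.391] -/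
theorem tauRec_mul_comm (X Y : Matrix (Fin N) (Fin N) ℂ) : tauRec N (X * Y) = tauRec N (Y * X) := by
  rw [Matrix.traceLinearMap_apply, Matrix.traceLinearMap_apply, Matrix.trace_mul_comm]

/-- ★ **`Δ′(U₀)` IS SYMMETRIC AT EVERY BACKGROUND OF RECORD** — [B9] (3.10) «For U with values in the unitary group U(N) it is a hermitian operator», curvature part,
with lit's three letters discharged. [cite: Balaban1985BackgroundPropagators, (3.10) p.392] -/
theorem curvOpOfRecord_isSymmetric [Fact (0 < c0Rec F K k)] (U₀ : GaugeField (F.P K) 0 (SU N)) :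
    (curvOp (c₀ := c0Rec F K k) (phiRec N) (tauRec N) ((F.P K).eta k) (unitsOfRecord F N U₀)).IsSymmetric :=
  curvOp_isSymmetric (phiRec N) (tauRec N) (tauRec_star N) (tauRec_mul_comm N) ((F.P K).eta k) (star_coe_unitsOfRecord F N U₀)

/-- ★★★ **`Δ(U₀) = D*D + Δ′` OF RECORD IS SYMMETRIC AT EVERY BACKGROUND, HYPOTHESIS-FREE** (off the flat orbit included) — lit ✓`hessOp_isSymmetric_of_trace` with
unitary `unitsOfRecord`, `*`-trace, cyclic trace and ✓`inner_phiRec_symm`. [cite: Balaban1985BackgroundPropagators, (3.10) p.392; Balaban1985Averaging, (18) p.21] -/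
theorem hessOpOfRecord_isSymmetric [Fact (0 < c0Rec F K k)] (U₀ : GaugeField (F.P K) 0 (SU N)) : (hessOpOfRecord F N k U₀).IsSymmetric :=
  hessOp_isSymmetric_of_trace (phiRec N) (tauRec N) (tauRec_star N) (tauRec_mul_comm N) ((F.P K).eta k) (star_coe_unitsOfRecord F N U₀)
    inner_phiRec_symm

/-- `Δ(U₀) + Δ⁽²⁾` is symmetric for a symmetric datum `Δ⁽²⁾` (the operator inside 3f′'s slot (c)). [cite: Balaban1985BackgroundPropagators, (3.128) p.421, (3.10) p.392] -/
theorem hessOpOfRecord_add_isSymmetric [Fact (0 < c0Rec F K k)] (U₀ : GaugeField (F.P K) 0 (SU N))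
    {Δ2 : BondL2K ℂ (F.P K).d (fun _ => (F.P K).sitesPerDir 0) (c0Rec F K k) (WRec N) →ₗ[ℂ]
      BondL2K ℂ (F.P K).d (fun _ => (F.P K).sitesPerDir 0) (c0Rec F K k) (WRec N)} (hΔ2 : Δ2.IsSymmetric) :
    (hessOpOfRecord F N k U₀ + Δ2).IsSymmetric :=
  (hessOpOfRecord_isSymmetric F N k U₀).add hΔ2

/-! ## §2  The `π`-sandwiched slots of ✓3f′ are symmetric -/

/-- **`T†ST` IS SYMMETRIC WHEN `S` IS** (finite-dimensional Hilbert space). [folklore] -/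
theorem isSymmetric_adjoint_comp_comp {E : Type*} [NormedAddCommGroup E] [InnerProductSpace ℂ E] [FiniteDimensional ℂ E]
    (T S : E →ₗ[ℂ] E) (hS : S.IsSymmetric) : (LinearMap.adjoint T ∘ₗ S ∘ₗ T).IsSymmetric := by
  intro x y
  simp only [LinearMap.comp_apply]
  rw [LinearMap.adjoint_inner_left, hS, ← LinearMap.adjoint_inner_right]

variable {F' : Type*} [AddCommGroup F'] [Module ℂ F']

/-- ★★ **SLOT (b): `Δ_π(U₀) = π†Δ(U₀)π` IS SYMMETRIC** for ANY `G′`, `Q′` (3f′ `hessOpOfRecordPi`), hypothesis-free. [cite: Balaban1985BackgroundPropagators, (3.119) p.419, (3.10) p.392] -/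
theorem hessOpOfRecordPi_isSymmetric [Fact (0 < c0Rec F K k)] (U₀ : GaugeField (F.P K) 0 (SU N))
    (Gp : SiteL2K ℂ (F.P K).d (fun _ => (F.P K).sitesPerDir 0) (c0Rec F K k) (WRec N) →ₗ[ℂ]
      SiteL2K ℂ (F.P K).d (fun _ => (F.P K).sitesPerDir 0) (c0Rec F K k) (WRec N))
    (Q' : SiteL2K ℂ (F.P K).d (fun _ => (F.P K).sitesPerDir 0) (c0Rec F K k) (WRec N) →ₗ[ℂ] F') :
    (hessOpOfRecordPi F N k U₀ Gp Q').IsSymmetric :=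
  isSymmetric_adjoint_comp_comp _ _ (hessOpOfRecord_isSymmetric F N k U₀)

/-- ★★ **SLOT (c): `π†(Δ(U₀) + Δ⁽²⁾)π` IS SYMMETRIC** for ANY `G′`, `Q′` and any SYMMETRIC datum `Δ⁽²⁾` (3f′ `hessOpOfRecord128`).
[cite: Balaban1985BackgroundPropagators, (3.128) p.421, (3.135) p.422, (3.10) p.392] -/
theorem hessOpOfRecord128_isSymmetric [Fact (0 < c0Rec F K k)] (U₀ : GaugeField (F.P K) 0 (SU N))
    (Gp : SiteL2K ℂ (F.P K).d (fun _ => (F.P K).sitesPerDir 0) (c0Rec F K k) (WRec N) →ₗ[ℂ]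
      SiteL2K ℂ (F.P K).d (fun _ => (F.P K).sitesPerDir 0) (c0Rec F K k) (WRec N))
    (Q' : SiteL2K ℂ (F.P K).d (fun _ => (F.P K).sitesPerDir 0) (c0Rec F K k) (WRec N) →ₗ[ℂ] F')
    {Δ2 : BondL2K ℂ (F.P K).d (fun _ => (F.P K).sitesPerDir 0) (c0Rec F K k) (WRec N) →ₗ[ℂ]
      BondL2K ℂ (F.P K).d (fun _ => (F.P K).sitesPerDir 0) (c0Rec F K k) (WRec N)} (hΔ2 : Δ2.IsSymmetric) :
    (hessOpOfRecord128 F N k U₀ Gp Q' Δ2).IsSymmetric :=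
  isSymmetric_adjoint_comp_comp _ _ (hessOpOfRecord_add_isSymmetric F N k U₀ hΔ2)

/-- **(110)'s `Δ_{1,a}(U₀; Δ₁) = Δ₁ + DRD* + aQ*Q` IS SYMMETRIC FOR A SYMMETRIC SLOT `Δ₁`** (any bond letter `Q`, any `Q′`; lit ✓`laplaceALatticeK_isSymmetric` with the record's
`conj c = c`, mutually adjoint transporters, ✓`RrOfRecord_isSymmetric`). [cite: Balaban1985Variational, (110) p.294; Balaban1985BackgroundPropagators, (3.21) p.394] -/
theorem laplaceAOfRecordAt_isSymmetric [Fact (0 < c0Rec F K k)] (U₀ : GaugeField (F.P K) 0 (SU N))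
    {β : Type*} [Fintype β] {wB : β → ℝ} [Fact (∀ y, 0 < wB y)]
    {Δ₁ : BondL2K ℂ (F.P K).d (fun _ => (F.P K).sitesPerDir 0) (c0Rec F K k) (WRec N) →ₗ[ℂ]
      BondL2K ℂ (F.P K).d (fun _ => (F.P K).sitesPerDir 0) (c0Rec F K k) (WRec N)} (hΔ₁ : Δ₁.IsSymmetric)
    (Q : BondL2K ℂ (F.P K).d (fun _ => (F.P K).sitesPerDir 0) (c0Rec F K k) (WRec N) →ₗ[ℂ] WL2 ℂ wB (WRec N))
    (Q' : SiteL2K ℂ (F.P K).d (fun _ => (F.P K).sitesPerDir 0) (c0Rec F K k) (WRec N) →ₗ[ℂ] F') (a : ℝ) :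
    (laplaceAOfRecordAt F N k U₀ Δ₁ Q Q' a).IsSymmetric :=
  laplaceALatticeK_isSymmetric (conj_cRec F K k) (inner_RRec_left U₀) hΔ₁ (RrOfRecord_isSymmetric (F := F) (N := N) (k := k) (U₀ := U₀) (Q' := Q'))

/-- ★ **(110)'s OPERATOR FOR SLOT (c) IS SYMMETRIC** at every background, any `G′`, symmetric `Δ⁽²⁾` — the `hsymm` companion of the displayed `hpos`.
[cite: Balaban1985Variational, (110) p.294; Balaban1985BackgroundPropagators, (3.128) p.421] -/
theorem laplaceAOfRecordAt128_isSymmetric [Fact (0 < c0Rec F K k)] (U₀ : GaugeField (F.P K) 0 (SU N))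
    {β : Type*} [Fintype β] {wB : β → ℝ} [Fact (∀ y, 0 < wB y)]
    (Gp : SiteL2K ℂ (F.P K).d (fun _ => (F.P K).sitesPerDir 0) (c0Rec F K k) (WRec N) →ₗ[ℂ]
      SiteL2K ℂ (F.P K).d (fun _ => (F.P K).sitesPerDir 0) (c0Rec F K k) (WRec N))
    {Δ2 : BondL2K ℂ (F.P K).d (fun _ => (F.P K).sitesPerDir 0) (c0Rec F K k) (WRec N) →ₗ[ℂ]
      BondL2K ℂ (F.P K).d (fun _ => (F.P K).sitesPerDir 0) (c0Rec F K k) (WRec N)} (hΔ2 : Δ2.IsSymmetric)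
    (Q : BondL2K ℂ (F.P K).d (fun _ => (F.P K).sitesPerDir 0) (c0Rec F K k) (WRec N) →ₗ[ℂ] WL2 ℂ wB (WRec N))
    (Q' : SiteL2K ℂ (F.P K).d (fun _ => (F.P K).sitesPerDir 0) (c0Rec F K k) (WRec N) →ₗ[ℂ] F') (a : ℝ) :
    (laplaceAOfRecordAt F N k U₀ (hessOpOfRecord128 F N k U₀ Gp Q' Δ2) Q Q' a).IsSymmetric :=
  laplaceAOfRecordAt_isSymmetric F N k U₀ (hessOpOfRecord128_isSymmetric F N k U₀ Gp Q' hΔ2) Q Q' a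

/-! ## §3  [15] p.294 «𝔊 … satisfying Q𝔊 = 0, RD*𝔊 = 0» FOR THE SLOT-(c) HANDLE OF ✓3f′ AT EVERY GUARDED BACKGROUND -/

section Slice

variable [NeZero N] [Fact (0 < (F.L : ℝ))] [Fact (0 < (F.P K).eta k)] [Fact (0 < c0Rec F K k)] [Fact (∀ c, 0 < wBRec F K k c)]
  (Ω : ℕ → Set (Site (F.P K) 0)) (U₀ : GaugeField (F.P K) 0 (SU N))
  (T' : SiteL2K ℂ (F.P K).d (fun _ => (F.P K).sitesPerDir 0) (c0Rec F K k) (WRec N) →ₗ[ℂ] SiteL2K ℂ (F.P K).d (fun _ => (F.P K).sitesPerDir 0) (c0Rec F K k) (WRec N))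
  (hpos' : ∀ x, x ≠ 0 → 0 < RCLike.re ⟪x, T' x⟫_ℂ)
  (hT' : ∀ l, QflatOfRecord F N k l = 0 → T' l = covLaplaceSiteK (cRec F K k) (RRec F N U₀) (SRec F N U₀) l)
  {Δ2 : BondL2K ℂ (F.P K).d (fun _ => (F.P K).sitesPerDir 0) (c0Rec F K k) (WRec N) →ₗ[ℂ]
    BondL2K ℂ (F.P K).d (fun _ => (F.P K).sitesPerDir 0) (c0Rec F K k) (WRec N)} (hΔ2 : Δ2.IsSymmetric) {a : ℝ}
  (hpos : ∀ x, x ≠ 0 → 0 < RCLike.re ⟪x, laplaceAOfRecordAt F N k U₀ (hessOpOfRecord128 F N k U₀ (greenK T' hpos') (QflatOfRecord F N k) Δ2)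
      (QOfRecord F N k U₀) (QflatOfRecord F N k) a x⟫_ℂ)

set_option maxRecDepth 16384 in
include hT' hΔ2 in
/-- ★★★ **AT EVERY GUARDED BACKGROUND `U₀`: `𝔊(U₀) f ∈ (102)` FOR EVERY CURRENT `f`**, for 3f′'s slot-(c) handle `frakGOfRecordAtBg128` with print's `G′ := (T′)⁻¹`
(`T′` positive, `= Δ_{U₀}` on `N(Q′♭)`) and ANY symmetric datum `Δ⁽²⁾` — i.e. (117)'s «`Q𝔊 = 0, RD*𝔊 = 0`» — lit ✓`frakGLatticeCLM_mem_constraint102_of_gaugeModes` with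
(g1) := ✓`hessOpOfRecord128_gaugeMode` ((g5) := ✓`printGreen_gaugeMode_ofRecord`), (g2) := ✓`QOfRecord_covDerivL2K_eq_zero_of_QflatOfRecord_eq_zero` (guard), `hΔ` := §2,
`conj c = c`, adjoint transporters DISCHARGED; modulo ONLY the displayed `hpos` ([B9] Thm 3.12) and `hQ`.
[cite: Balaban1985Variational, (102) p.293, (110)–(111) p.294, (117) p.295; Balaban1985BackgroundPropagators, (3.124) p.420, (3.128) p.421] -/
theorem frakGOfRecordAtBg128_mem_constraint102 (hQ : Function.Surjective (QOfRecord F N k U₀)) (hguard : SmallBelow (avOfRecord F N K) k U₀)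
    (f : NegSizeLit F N K k Ω 3) :
    frakGOfRecordAtBg128 F N K k Ω U₀ (greenK T' hpos') Δ2 a hpos hQ f ∈
      constraint102 (L := (F.L : ℝ)) (η := (F.P K).eta k) (lev₀ := bondLevLit F Ω k) (pairLevLit F Ω k)
        (nabla115 ((F.P K).eta k) (unitsOfRecord F N U₀))
        (QFun (phiRec N) (QOfRecord F N k U₀))
        (B11Eq103H1Complex.RLatticeK (cRec F K k) (RRec F N U₀) (SRec F N U₀) (QflatOfRecord F N k))
        (DstarFun (phiRec N) (covDivL2K ℂ (c0Rec F K k) (cRec F K k) (SRec F N U₀))) :=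
  B9Eq3124GaugeModes.frakGLatticeCLM_mem_constraint102_of_gaugeModes (phiRec N) hpos hQ (pairLevLit F Ω k)
    (nabla115 ((F.P K).eta k) (unitsOfRecord F N U₀)) (conj_cRec F K k) (inner_RRec_left U₀)
    (hessOpOfRecord128_isSymmetric F N k U₀ (greenK T' hpos') (QflatOfRecord F N k) hΔ2)
    (fun _ hl => hessOpOfRecord128_gaugeMode F N k U₀ (greenK T' hpos') (QflatOfRecord F N k) Δ2
      (fun _ hl' => printGreen_gaugeMode_ofRecord F N k U₀ T' hpos' hT' hl') hl)
    (fun l hl => QOfRecord_covDerivL2K_eq_zero_of_QflatOfRecord_eq_zero F k U₀ hguard l hl) f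

/-! ## §4  The same on [15] (2)'s class `𝔘_k`: `hQ` and the guard discharged -/

set_option maxRecDepth 16384 in
include hT' hΔ2 in
/-- ★★★ **FOR EVERY MEMBER `U₀` OF [15] (2)'s SPACE `𝔘_k({T}, ε₀)`** (`Node00.InUkClassB11`; `ε₀` below the four explicit ceilings, `k ≤ m + K`): `𝔊(U₀) f ∈ (102)` for the slot-(c)
handle, for every current `f` — `hQ` by ✓`QOfRecord_surjective_of_inUkClassB11`, the guard by ✓`smallBelow_of_plaqSmall` ∘ ✓`plaqSmall_avgFamily_of_mem_bgReg` ([B7] Prop. 2) —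
modulo the displayed `hpos` ALONE. [cite: Balaban1985Variational, (2) p.278, (102) p.293, (117) p.295; Balaban1985Averaging, Prop. 2 p.26; Balaban1985BackgroundPropagators, (3.128) p.421] -/
theorem frakGOfRecordAtBg128_mem_constraint102_of_inUkClassB11 (hk : k ≤ (F.P K).m + (F.P K).K) {ε₀ : ℝ} (hε₀ : 0 < ε₀)
    (h3 : (143 * (((((F.P K).d + 4 : ℕ) : ℝ)) ^ 2 / 4) ^ 2) * ε₀ ≤ 1 / 3)
    (h2 : 2 * ε₀ ≤ 2 * deltaSU (Fin N) / ((((F.P K).d + 4) * (F.P K).L : ℕ) : ℝ) ^ 2)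
    (hst : stokesConst (F.P K) * (2 * ε₀) < emlWeight (F.P K) / 16) (hstδ : stokesConst (F.P K) * (2 * ε₀) < deltaSU (Fin N))
    (hU : InUkClassB11 F N K k ε₀ U₀) (f : NegSizeLit F N K k Ω 3) :
    frakGOfRecordAtBg128 F N K k Ω U₀ (greenK T' hpos') Δ2 a hpos (QOfRecord_surjective_of_inUkClassB11 hk hε₀ h3 h2 hst hstδ hU) f ∈
      constraint102 (L := (F.L : ℝ)) (η := (F.P K).eta k) (lev₀ := bondLevLit F Ω k) (pairLevLit F Ω k)
        (nabla115 ((F.P K).eta k) (unitsOfRecord F N U₀))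
        (QFun (phiRec N) (QOfRecord F N k U₀))
        (B11Eq103H1Complex.RLatticeK (cRec F K k) (RRec F N U₀) (SRec F N U₀) (QflatOfRecord F N k))
        (DstarFun (phiRec N) (covDivL2K ℂ (c0Rec F K k) (cRec F K k) (SRec F N U₀))) :=
  frakGOfRecordAtBg128_mem_constraint102 F N k Ω U₀ T' hpos' hT' hΔ2 hpos _
    (smallBelow_of_plaqSmall (by positivity : (0 : ℝ) < 2 * ε₀) hstδ fun i hi => plaqSmall_avgFamily_of_mem_bgReg hε₀ h3 h2 hU.mem_bgReg hi.le) f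

end Slice

end Summit.QuantumFields.YangMills.Theorems.N07HessOpOfRecordSymmetric
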